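import Mathlib
import HarnessLib
import Summits.AtomisticToContinuum.Crystallization.Theorems.PricedLinkCensusSoftLayerPropagationOneStackingMapSearchDefs
import Summits.AtomisticToContinuum.Crystallization.Theorems.PricedLinkCensusSoftLayerPropagationOneStackingMapSearchBasic

/-!
# One-stacking map engine: soundness of the completion table

Route `PricedLinkCensus`, crux `SoftLayerPropagation` (stmt-AtomisticToContinuum-14233), line
`Sketch`, stub `stub_oneStackingMap`.  **`completions_sound`**: if a real linear isometry `Q`
carries the FCC or HCP model onto a star containing the recorded partial star `W` (in shadow
coordinates `toE3`), and `completions TABLE W = some cands`, then some candidate `V ∈ cands` IS that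
star: `Q '' P₀ = V` pointwise.  Proof: the three basis vectors `wᵢ` picked from `W` have preimages
`fᵢ ∈ P₀` with the same Gram matrix (isometry), hence the same key and a non-zero determinant
(`det² = Gram determinant`); Cramer's identity `det(f) p = Σ numerᵢ(p) fᵢ`, pushed through `Q`,
shows `Q p = (Σ numerᵢ(p) wᵢ)/det(f)`, which is what `genV` computes from ANY table entry with the
same key and the same coefficient set — and the deduplicated table keeps one.  All [folklore].
-/

noncomputable section

namespace Summit.AtomisticToContinuum.Crystallization.Theorems

namespace OneStacking

open RealInnerProductSpace V3

/-! ### Polynomial identities -/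

/-- The linear combination `n₀ w₀ + n₁ w₁ + n₂ w₂`. [folklore] -/
def lin (n w0 w1 w2 : V3) : V3 := add (add (smul n.x w0) (smul n.y w1)) (smul n.z w2)

/-- **Cramer's identity**: `det(a,b,c) p = det(p,b,c) a + det(a,p,c) b + det(a,b,p) c`. [folklore] -/
theorem cramer (a b c p : V3) : smul (det a b c) p = lin (numer a b c p) a b c := by
  cases a; cases b; cases c; cases p
  simp only [smul, lin, numer, det, add, V3.mk.injEq]
  exact ⟨by ring, by ring, by ring⟩

/-- **The Gram determinant**: `det(a,b,c)²` is a polynomial in the pairwise inner products. [folklore] -/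
theorem det_sq_eq (a b c : V3) : det a b c ^ 2 =
    n2 a * (n2 b * n2 c - dot b c ^ 2) - dot a b * (dot a b * n2 c - dot b c * dot a c) +
      dot a c * (dot a b * dot b c - n2 b * dot a c) := by
  cases a; cases b; cases c; simp only [det, n2, dot]; ring

/-- `det (a, a, c) = 0`. [folklore] -/
theorem det_self_left (a c : V3) : det a a c = 0 := by cases a; cases c; simp only [det]; ring
/-- `det (a, b, a) = 0`. [folklore] -/
theorem det_self_outer (a b : V3) : det a b a = 0 := by cases a; cases b; simp only [det]; ring
/-- `det (a, b, b) = 0`. [folklore] -/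
theorem det_self_right (a b : V3) : det a b b = 0 := by cases a; cases b; simp only [det]; ring

/-- `toE3` of a linear combination. [folklore] -/
theorem toE3_lin (n w0 w1 w2 : V3) :
    toE3 (lin n w0 w1 w2) = (n.x : ℝ) • toE3 w0 + (n.y : ℝ) • toE3 w1 + (n.z : ℝ) • toE3 w2 := by
  simp only [lin, toE3_add, toE3_smul]

/-- Scaling the coefficients scales the combination. [folklore] -/
theorem lin_smul (d : ℤ) (n w0 w1 w2 : V3) : lin (smul d n) w0 w1 w2 = smul d (lin n w0 w1 w2) := by
  cases n; cases w0; cases w1; cases w2; simp only [lin, smul, add, V3.mk.injEq]; exact ⟨by ring, by ring, by ring⟩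

/-- Cancelling a non-zero integer factor. [folklore] -/
theorem smul_cancel {d : ℤ} (hd : d ≠ 0) {u v : V3} (h : smul d u = smul d v) : u = v := by
  cases u; cases v
  simp only [smul, V3.mk.injEq] at h ⊢
  exact ⟨mul_left_cancel₀ hd h.1, mul_left_cancel₀ hd h.2.1, mul_left_cancel₀ hd h.2.2⟩

/-- **Meaning of `comb?`**: `comb? d n w = some v` gives `d • v = n₀ w₀ + n₁ w₁ + n₂ w₂`. [folklore] -/
theorem comb?_spec {d : ℤ} {n w0 w1 w2 v : V3} (h : comb? d n w0 w1 w2 = some v) :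
    smul d v = lin n w0 w1 w2 := by
  unfold comb? at h
  simp only at h
  split_ifs at h with hc
  obtain ⟨hx, hy, hz⟩ := hc
  rw [Option.some.injEq] at h
  subst h
  simp only [smul, lin]
  congr 1
  · exact Int.mul_ediv_cancel' (Int.dvd_of_emod_eq_zero hx)
  · exact Int.mul_ediv_cancel' (Int.dvd_of_emod_eq_zero hy)
  · exact Int.mul_ediv_cancel' (Int.dvd_of_emod_eq_zero hz)

/-! ### The table -/

/-- Membership in `triples`. [folklore] -/
theorem mem_triples {P : List V3} {f0 f1 f2 : V3} (h0 : f0 ∈ P) (h1 : f1 ∈ P) (h2 : f2 ∈ P)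
    (h01 : f0 ≠ f1) (h02 : f0 ≠ f2) (h12 : f1 ≠ f2) : (f0, f1, f2) ∈ triples P := by
  simp only [triples, List.mem_flatMap, List.mem_filterMap]
  exact ⟨f0, h0, f1, h1, f2, h2, by simp [h01, h02, h12]⟩

/-- The raw entry of a spanning triple is in the raw table. [folklore] -/
theorem mem_rawTable {P : List V3} {f0 f1 f2 : V3} (ht : (f0, f1, f2) ∈ triples P) (hd : det f0 f1 f2 ≠ 0) :
    (⟨(dot f0 f1, dot f0 f2, dot f1 f2), det f0 f1 f2, P.map (numer f0 f1 f2)⟩ : CEntry) ∈ rawTable P := by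
  simp only [rawTable, List.mem_filterMap]
  exact ⟨(f0, f1, f2), ht, by simp [hd]⟩

/-- Entries of the raw table have non-zero denominator. [folklore] -/
theorem den_ne_zero_of_mem_rawTable {P : List V3} {e : CEntry} (h : e ∈ rawTable P) : e.den ≠ 0 := by
  simp only [rawTable, List.mem_filterMap] at h
  obtain ⟨t, -, ht⟩ := h
  split_ifs at ht with hd
  cases ht
  exact hd

/-- `equiv` is reflexive. [folklore] -/
theorem CEntry.equiv_refl (e : CEntry) : e.equiv e = true := by
  simp [CEntry.equiv, List.all_eq_true]

/-- The deduplicated table keeps an equivalent of every entry. [folklore] -/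
theorem exists_equiv_mem_dedupTable {l : List CEntry} {e : CEntry} (h : e ∈ l) :
    ∃ e' ∈ dedupTable l, e.equiv e' = true := by
  induction l with
  | nil => cases h
  | cons x xs ih =>
    simp only [dedupTable]
    rcases List.mem_cons.1 h with rfl | h
    · by_cases hany : (dedupTable xs).any (fun e' => e.equiv e') = true
      · rw [if_pos hany]
        obtain ⟨e', he', hq⟩ := List.any_eq_true.1 hany
        exact ⟨e', he', hq⟩
      · rw [if_neg hany]
        exact ⟨e, List.mem_cons_self, e.equiv_refl⟩
    · obtain ⟨e', he', hq⟩ := ih h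
      by_cases hany : (dedupTable xs).any (fun e' => x.equiv e') = true
      · rw [if_pos hany]; exact ⟨e', he', hq⟩
      · rw [if_neg hany]; exact ⟨e', List.mem_cons_of_mem _ he', hq⟩

/-- Entries of `TABLE` have non-zero denominator. [folklore] -/
theorem dedupTable_subset (l : List CEntry) : dedupTable l ⊆ l := by
  induction l with
  | nil => simp [dedupTable]
  | cons x xs ih =>
    simp only [dedupTable]
    split_ifs
    · exact fun e he => List.mem_cons_of_mem _ (ih he)
    · intro e he
      rcases List.mem_cons.1 he with rfl | he
      · exact List.mem_cons_self
      · exact List.mem_cons_of_mem _ (ih he)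

/-- Meaning of `equiv`: equal keys and, both ways, equal coefficient sets as rational triples.
[folklore] -/
theorem CEntry.equiv_iff (e e' : CEntry) : e.equiv e' = true ↔
    e.key = e'.key ∧ (∀ n ∈ e.nums, ∃ n' ∈ e'.nums, toQ3 e.den n = toQ3 e'.den n') ∧
      (∀ n' ∈ e'.nums, ∃ n ∈ e.nums, toQ3 e.den n = toQ3 e'.den n') := by
  simp only [CEntry.equiv, CEntry.coeffs, Bool.and_eq_true, decide_eq_true_eq, List.all_eq_true,
    List.contains_iff_mem, List.mem_map, and_assoc]
  constructor
  · rintro ⟨hk, h1, h2⟩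
    refine ⟨hk, fun n hn => ?_, fun n' hn' => ?_⟩
    · obtain ⟨n', hn', he⟩ := h1 _ ⟨n, hn, rfl⟩
      exact ⟨n', hn', he.symm⟩
    · obtain ⟨n, hn, he⟩ := h2 _ ⟨n', hn', rfl⟩
      exact ⟨n, hn, he⟩
  · rintro ⟨hk, h1, h2⟩
    refine ⟨hk, ?_, ?_⟩
    · rintro _ ⟨n, hn, rfl⟩
      obtain ⟨n', hn', he⟩ := h1 n hn
      exact ⟨n', hn', he.symm⟩
    · rintro _ ⟨n', hn', rfl⟩
      obtain ⟨n, hn, he⟩ := h2 n' hn'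
      exact ⟨n, hn, he⟩

/-- Equal rational coefficients give proportional numerators. [folklore] -/
theorem smul_eq_of_toQ3_eq {d d' : ℤ} (hd : d ≠ 0) (hd' : d' ≠ 0) {n n' : V3} (h : toQ3 d n = toQ3 d' n') :
    smul d' n = smul d n' := by
  obtain ⟨nx, ny, nz⟩ := n
  obtain ⟨mx, my, mz⟩ := n'
  simp only [toQ3, Q3.mk.injEq] at h
  have hdq : (d : ℚ) ≠ 0 := by exact_mod_cast hd
  have hdq' : (d' : ℚ) ≠ 0 := by exact_mod_cast hd'
  obtain ⟨h1, h2, h3⟩ := h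
  rw [div_eq_div_iff hdq hdq'] at h1 h2 h3
  simp only [smul, V3.mk.injEq]
  refine ⟨?_, ?_, ?_⟩
  · have : ((d' * nx : ℤ) : ℚ) = ((d * mx : ℤ) : ℚ) := by push_cast; linarith [h1]
    exact_mod_cast this
  · have : ((d' * ny : ℤ) : ℚ) = ((d * my : ℤ) : ℚ) := by push_cast; linarith [h2]
    exact_mod_cast this
  · have : ((d' * nz : ℤ) : ℚ) = ((d * mz : ℤ) : ℚ) := by push_cast; linarith [h3]
    exact_mod_cast this

/-! ### `mapM` in `Option` -/

/-- `mapM = some`: every input has an output in the result. [folklore] -/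
theorem exists_mem_of_mapM_eq_some {α β : Type} {f : α → Option β} {l : List α} {r : List β}
    (h : l.mapM f = some r) {a : α} (ha : a ∈ l) : ∃ b ∈ r, f a = some b := by
  induction l generalizing r with
  | nil => cases ha
  | cons x xs ih =>
    rw [List.mapM_cons] at h
    cases hfx : f x with
    | none => rw [hfx] at h; cases h
    | some b =>
      rw [hfx] at h
      simp only [Option.pure_def, Option.bind_eq_bind, Option.bind_some] at h
      cases hxs : xs.mapM f with
      | none => rw [hxs] at h; cases h
      | some bs =>
        rw [hxs] at h
        simp only [Option.bind_some] at h
        cases h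
        rcases List.mem_cons.1 ha with rfl | ha
        · exact ⟨b, List.mem_cons_self, hfx⟩
        · obtain ⟨b', hb', hf⟩ := ih hxs ha
          exact ⟨b', List.mem_cons_of_mem _ hb', hf⟩

/-- `mapM = some`: every output comes from an input. [folklore] -/
theorem exists_mem_of_mem_mapM_eq_some {α β : Type} {f : α → Option β} {l : List α} {r : List β}
    (h : l.mapM f = some r) {b : β} (hb : b ∈ r) : ∃ a ∈ l, f a = some b := by
  induction l generalizing r with
  | nil => rw [List.mapM_nil] at h; cases h; cases hb
  | cons x xs ih =>
    rw [List.mapM_cons] at h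
    cases hfx : f x with
    | none => rw [hfx] at h; cases h
    | some b0 =>
      rw [hfx] at h
      simp only [Option.pure_def, Option.bind_eq_bind, Option.bind_some] at h
      cases hxs : xs.mapM f with
      | none => rw [hxs] at h; cases h
      | some bs =>
        rw [hxs] at h
        simp only [Option.bind_some] at h
        cases h
        rcases List.mem_cons.1 hb with rfl | hb
        · exact ⟨x, List.mem_cons_self, hfx⟩
        · obtain ⟨a, ha, hf⟩ := ih hxs hb
          exact ⟨a, List.mem_cons_of_mem _ ha, hf⟩

/-! ### The basis picked from `W` -/

/-- `pickBasis W = some (w₀, w₁, w₂)`: three members of `W` with non-zero determinant. [folklore] -/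
theorem pickBasis_spec {W : List V3} {w0 w1 w2 : V3} (h : pickBasis W = some (w0, w1, w2)) :
    w0 ∈ W ∧ w1 ∈ W ∧ w2 ∈ W ∧ det w0 w1 w2 ≠ 0 := by
  unfold pickBasis at h
  obtain ⟨a, ha, h⟩ := List.exists_of_findSome?_eq_some h
  obtain ⟨b, hb, h⟩ := List.exists_of_findSome?_eq_some h
  obtain ⟨c, hc, h⟩ := List.exists_of_findSome?_eq_some h
  split_ifs at h with hd
  cases h
  exact ⟨ha, hb, hc, hd⟩

/-! ### Soundness of `completions` -/

/-- **Soundness of the completion table.**  See the file header. [folklore] -/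
theorem completions_sound (Q : E3 →ₗᵢ[ℝ] E3) {P0 : List V3} (hP0 : P0 = FCC ∨ P0 = HCP)
    {W : List V3} (hW : ∀ w ∈ W, ∃ p ∈ P0, Q (toE3 p) = toE3 w)
    {cands : List (List V3)} (hc : completions TABLE W = some cands) :
    ∃ V ∈ cands, (∀ p ∈ P0, ∃ v ∈ V, Q (toE3 p) = toE3 v) ∧ (∀ v ∈ V, ∃ p ∈ P0, Q (toE3 p) = toE3 v) := by
  -- the basis
  unfold completions at hc
  cases hpick : pickBasis W with
  | none => rw [hpick] at hc; cases hc
  | some www =>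
  obtain ⟨w0, w1, w2⟩ := www
  rw [hpick] at hc
  simp only [Option.map_eq_some_iff] at hc
  obtain ⟨Vs, hVs, rfl⟩ := hc
  obtain ⟨hw0, hw1, hw2, hdetw⟩ := pickBasis_spec hpick
  obtain ⟨f0, hf0, hQ0⟩ := hW w0 hw0
  obtain ⟨f1, hf1, hQ1⟩ := hW w1 hw1
  obtain ⟨f2, hf2, hQ2⟩ := hW w2 hw2
  -- Gram entries agree
  have hS2 : ((S : ℝ) ^ 2) ≠ 0 := pow_ne_zero 2 S_real.1
  have gram : ∀ {f f' w w' : V3}, Q (toE3 f) = toE3 w → Q (toE3 f') = toE3 w' → dot f f' = dot w w' := by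
    intro f f' w w' h h'
    have := Q.inner_map_map (toE3 f) (toE3 f')
    rw [h, h', inner_toE3, inner_toE3, div_left_inj' hS2] at this
    exact_mod_cast this.symm
  have g00 := gram hQ0 hQ0; have g01 := gram hQ0 hQ1; have g02 := gram hQ0 hQ2
  have g11 := gram hQ1 hQ1; have g12 := gram hQ1 hQ2; have g22 := gram hQ2 hQ2
  -- non-zero determinant
  have hdetf : det f0 f1 f2 ≠ 0 := by
    intro h0
    have h1 : det f0 f1 f2 ^ 2 = det w0 w1 w2 ^ 2 := by
      rw [det_sq_eq, det_sq_eq]; simp only [n2]; rw [g00, g01, g02, g11, g12, g22]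
    rw [h0] at h1
    exact hdetw (pow_eq_zero_iff two_ne_zero |>.1 h1.symm)
  -- distinct preimages
  have hinj : ∀ {f f' w w' : V3}, Q (toE3 f) = toE3 w → Q (toE3 f') = toE3 w' → f = f' → w = w' := by
    intro f f' w w' h h' hff
    subst hff; exact toE3_injective (h.symm.trans h')
  have h01 : f0 ≠ f1 := fun h => hdetw (by rw [hinj hQ0 hQ1 h]; exact det_self_left _ _)
  have h02 : f0 ≠ f2 := fun h => hdetw (by rw [hinj hQ0 hQ2 h]; exact det_self_outer _ _)
  have h12 : f1 ≠ f2 := fun h => hdetw (by rw [hinj hQ1 hQ2 h]; exact det_self_right _ _)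
  -- the raw entry and its kept equivalent
  set d := det f0 f1 f2 with hd
  have hraw := mem_rawTable (mem_triples hf0 hf1 hf2 h01 h02 h12) hdetf
  obtain ⟨e', he', hequiv⟩ := exists_equiv_mem_dedupTable hraw
  have he'T : e' ∈ TABLE := by
    rcases hP0 with rfl | rfl
    · exact List.mem_append_left _ he'
    · exact List.mem_append_right _ he'
  have hd' : e'.den ≠ 0 := den_ne_zero_of_mem_rawTable (dedupTable_subset _ he')
  rw [CEntry.equiv_iff] at hequiv
  obtain ⟨hkey, hfwd, hbwd⟩ := hequiv
  simp only at hkey hfwd hbwd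
  -- e' is among the filtered entries, hence generated
  have hfilt : e' ∈ TABLE.filter (fun e => e.key = (dot w0 w1, dot w0 w2, dot w1 w2)) := by
    rw [List.mem_filter]; exact ⟨he'T, by simp [← hkey, g01, g02, g12]⟩
  obtain ⟨V, hVmem, hgen⟩ := exists_mem_of_mapM_eq_some hVs hfilt
  -- the key computation: a numerator triple of `p` in any proportional form generates `Q p`
  have main : ∀ {p n' v : V3}, p ∈ P0 → toQ3 d (numer f0 f1 f2 p) = toQ3 e'.den n' →
      comb? e'.den n' w0 w1 w2 = some v → Q (toE3 p) = toE3 v := by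
    intro p n' v hp hq hv
    have hc := cramer f0 f1 f2 p
    -- push Cramer through `toE3` and `Q`
    have hreal : (d : ℝ) • Q (toE3 p) = toE3 (lin (numer f0 f1 f2 p) w0 w1 w2) := by
      have := congrArg (fun u => Q (toE3 u)) hc
      simp only [toE3_smul, toE3_lin, map_smul, map_add] at this
      rw [hQ0, hQ1, hQ2] at this
      rw [toE3_lin]; exact this
    -- proportionality of numerators
    have hprop := smul_eq_of_toQ3_eq hdetf hd' hq
    have hspec := comb?_spec hv
    have hlin : lin (numer f0 f1 f2 p) w0 w1 w2 = smul d v := by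
      apply smul_cancel hd'
      rw [← lin_smul, hprop, lin_smul, ← hspec]
      cases v; simp only [smul, V3.mk.injEq]; exact ⟨by ring, by ring, by ring⟩
    rw [hlin, toE3_smul] at hreal
    have hdR : (d : ℝ) ≠ 0 := by exact_mod_cast hdetf
    exact smul_right_injective _ hdR hreal
  -- the two inclusions
  have fwd : ∀ p ∈ P0, ∃ v ∈ V, Q (toE3 p) = toE3 v := by
    intro p hp
    obtain ⟨n', hn', hq⟩ := hfwd (numer f0 f1 f2 p) (List.mem_map.2 ⟨p, hp, rfl⟩)
    obtain ⟨v, hv, hcomb⟩ := exists_mem_of_mapM_eq_some hgen hn'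
    exact ⟨v, hv, main hp hq hcomb⟩
  have bwd : ∀ v ∈ V, ∃ p ∈ P0, Q (toE3 p) = toE3 v := by
    intro v hv
    obtain ⟨n', hn', hcomb⟩ := exists_mem_of_mem_mapM_eq_some hgen hv
    obtain ⟨n, hn, hq⟩ := hbwd n' hn'
    obtain ⟨p, hp, rfl⟩ := List.mem_map.1 hn
    exact ⟨p, hp, main hp hq hcomb⟩
  refine ⟨V, ?_, fwd, bwd⟩
  rw [List.mem_filter]
  refine ⟨hVmem, List.all_eq_true.2 fun w hw => ?_⟩
  obtain ⟨p, hp, hQp⟩ := hW w hw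
  obtain ⟨v, hv, hv'⟩ := fwd p hp
  rw [hQp] at hv'
  rw [toE3_injective hv']
  simpa using hv

end OneStacking

end Summit.AtomisticToContinuum.Crystallization.Theorems
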